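import Summits.QuantumFields.BalabanUV.T4Continuum.Support.B13Represents
import Summits.QuantumFields.BalabanUV.T4Continuum.Support.B13TermRep

/-!
# NE5 ∕ U3 — O2-hist (STRUCTURAL), CAUCHY FACE: the history fibre envelope `HistFibreEnvelopeCl` of leaf L04 for the Ursell term
# family `B13StepTermFamily.term 𝒯 inc act` and for the model of record `B13Represents.Assembly.step`, AT ACTIVITY LEVEL

Cell `pub-balaban`, unit `b2b-balaban-t4-ne5-formalise-leaf-03` (NE5 formalisation swarm, LEAF PROVER 03, gen 2; journal INTENT
`CLAIMS.log` l.6438; `t4/formal/NE5/LEAVES.md` v1.3 row «O2-hist (L04 history half) … via `TermHistExpLinear` ∕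
`histSecant_of_expLinear` from O1-d2's (μ, Φ, Λ)»; companion file `Support/B13TermHistSecant.lean` = the secant face).
Summits-side new work under the LEAN PLACEMENT RULE (cell bookkeeping + kernel analysis; NOT a Literature module).
HONEST FRAMING: rung (B)+1 of the FINITE-VOLUME T⁴ continuum programme — NOT infinite
volume, NOT a mass gap, NOT the Clay problem, NOT a proof of NE5 (NOT PRINTED in [Balaban1987RG1]–[Balaban1989LargeFieldII]:
they print ε-UNIFORM bounds, never η-RATES; cell GAPS G-t4-U3-1).  HONEST DEPENDENCY (cell line, verbatim): continuum YM on T⁴ ⇐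
BetaPertH ∧ nine spine estimates (0/9 proved); BetaPertH ⇐ (D1) ∧ (D4) ∧ CAP+tail; G-an2-4 gates asym, D1 and NE2/3/4.

WHERE IT SITS.  Leaf L04 of the owner's skeleton (`SKELETON-NE5-P1.md`) is the two-species output wall W2 = `DataLipschitz`,
split by the tree into an OPERATOR half (`OpFibreEnvelope[Cl]`, wall O2-op — mathematics not in print, trigger c6: NOT touched
here) and a HISTORY half `HistFibreEnvelopeCl M W κ G` (`T4InputCauchyRateTermwise`: along every history segment within the
margin through a base point the output is `DiffContOnCl` on the unit disc and obeys the one-run envelope `G·e^{−κd(X)}`), whose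
tree producer `histFibreEnvelopeCl_of_termwise_hist` takes the slack `BoxInClass`, `TermRep`, the termwise majorant
`TermBound`∕`TermBudget` and `TermHistLineAnalytic` — the latter DISCHARGED from the structure `TermHistExpLinear` by
`termHistLineAnalytic_of_expLinear` — and which the END faces `ne5_at_of_stepModel_fibreCl₂_scale_nat` ∕
`…_termwise_expLinear_scale_nat` consume.  Row O1-d2 (leaf-08) typed [Balaban1988RG2Cluster] (2.13) as the Ursell terms
`term 𝒯 inc act` of ACTIVITY TERMS and EXHIBITED `TermHistExpLinear` ∕ `TermHistLineAnalytic` from the per-activity structure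
`ActExpLinearOn 𝒯 act D K W` (`termHistLineAnalytic_of_actExpLinear`, p207797; route P2's term data: `B13StepTermExpLinear`,
p208225); row O1-d3 (leaf-04) supplied `TermRep` and the class bound from the displayed majorant in BOTH currencies — X-blind
`TermBound`∕`TermBudget` (`termRep_b13_of_termBudget`) and PER-DOMAIN activity majorant + budget of `B13TermRep.actMajorant`
(`summable_term_of_actBound`, `classBound_b13_of_actBound`, p208307; the per-domain currency row O1-d1 showed necessary for
absolute labels, journal l.5621); row O1-e (leaf-09) assembled the model of record `Assembly.step` (`Out = out 𝒯 inc act` by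
`rfl`) with the slack `Assembly.boxInClass` from ROOM (p208313).  THIS FILE composes those BY NAME into the history-half
producer AT ACTIVITY LEVEL, adding the per-domain M-test the second currency needs.

WHAT IS PROVED (kernel; `[folklore]` throughout; nothing of the manuscripts under audit is asserted — every input is DATA, a
STRUCTURE shape or a displayed one-run binder with a KIND locator, trigger c3∕c4; no `def`):
* §1 `diffContOnCl_of_hasSum_majorant` — M-test on the closed unit disc with a summable majorant FAMILY (the per-domain form of
  the tree's `T4InputCauchyRateTermwise.diffContOnCl_of_termwise_path`: `Complex.differentiableOn_tsum_of_summable_norm` inside,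
  `continuousOn_tsum` up to the boundary); **`histFibreEnvelopeCl_b13_of_termBudget`** (X-blind currency: for ANY `M` with
  `M.Out = out 𝒯 inc act`, `BoxInClass ∧ TermBound κ a ∧ TermBudget a G ∧ ActExpLinearOn ⟹ HistFibreEnvelopeCl M W κ G` — the
  tree's producer with `TermRep`∕`TermHistLineAnalytic` supplied by rows O1-d3∕O1-d2 BY NAME; NO analyticity hypothesis);
  **`histFibreEnvelopeCl_b13_of_actBound`** (per-domain currency: `BoxInClass` ∧ the activity NORM majorant
  `‖act Z j q.1 q.2‖ ≤ A k g U Z j` on the factors of the tuples localizing at a step-`k` domain ((2.38) KIND, displayed) ∧ the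
  per-domain budget `Summable (actMajorant (A k g U) k X) ∧ Σ'ᵢ actMajorant ≤ G·e^{−κd(X)}` ((2.41)∕[26] KIND, displayed) ∧
  `ActExpLinearOn` ⟹ `HistFibreEnvelopeCl M W κ G`).
* §2 the same for the MODEL OF RECORD: `histFibreEnvelopeCl_step_of_actBound` (`𝔄.step BHist`; ROOM `rOp ≤ ROp`,
  `BHist + rHist ≤ RHist` ⟹ slack by `Assembly.boxInClass`; majorant∕budget∕structure on the ball class
  `ballClass (selfCtr 𝔄.raw 𝔄.histRef) ROp RHist`).
WHAT IS *NOT* HERE (honest).  No estimate on Bałaban's objects: the activity majorants, the per-domain budgets (leaf-08's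
follower (iii), the tree-graph summation, in progress) and the room stay DISPLAYED; the instantiation of `𝒯`, `act`, `D` on
[II]'s (2.14) terms is the instancer's (rows O1-a∕O4-r); O2-op, O3, O5 are walls (c6), untouched.  Headline discipline (c5):
«NE5 leaf L04-hist PRODUCED STRUCTURALLY (Cauchy face) for the Ursell term family ∕ model of record, modulo displayed
per-activity one-run binders of printed KIND» — NOT «L04 proved», NOT «NE5 proved»; 0∕12 leaves instantiated on Bałaban's
objects is unchanged by this file.  `FlowStep.BetaPertH`, (B), (B^μ) do not occur.  0 sorry; axioms ⊆ {propext,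
Classical.choice, Quot.sound}.
-/

noncomputable section

open Metric Set
open scoped BigOperators

namespace Summit.QuantumFields.BalabanUV.T4Continuum.B13TermHistEnvelope

open Literature.MathematicalPhysics.QuantumFieldTheory.Balaban1983to89.T4OutputRate (Carriers)
open Literature.MathematicalPhysics.QuantumFieldTheory.Balaban1983to89.T4InputCauchyRateData (StepModel)
open Literature.MathematicalPhysics.QuantumFieldTheory.Balaban1983to89.T4InputCauchyRateSpecies
  (BoxInClass ClassBound ballClass histSegment_mem_box)
open Literature.MathematicalPhysics.QuantumFieldTheory.Balaban1983to89.T4InputCauchyRateTermwise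
  (TermBound TermBudget TermHistLineAnalytic HistFibreEnvelopeCl histFibreEnvelopeCl_of_termwise_hist)
open Summit.QuantumFields.BalabanUV.T4Continuum.B13StepTermFamily
  (TermIndexing ActData ActExpLinearOn term out hasSum_term_out termHistLineAnalytic_of_actExpLinear)
open Summit.QuantumFields.BalabanUV.T4Continuum.B13TermRep
  (actMajorant norm_term_le_actMajorant summable_term_of_actBound termRep_b13_of_termBudget classBound_b13_of_actBound)
open Summit.QuantumFields.BalabanUV.T4Continuum.B13OpDatum (OpDatum)
open Summit.QuantumFields.BalabanUV.T4Continuum.B13Base (selfCtr)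
open Summit.QuantumFields.BalabanUV.T4Continuum.B13Represents (Assembly)

/-! ## §1 The Cauchy face at activity level: `HistFibreEnvelopeCl` from slack + structure + displayed majorant -/

section Cauchy

variable {ι : Type*}

/-- [folklore] **M-TEST ON THE CLOSED UNIT DISC WITH A SUMMABLE MAJORANT FAMILY** (the per-domain form of the tree's
`T4InputCauchyRateTermwise.diffContOnCl_of_termwise_path`): if `f ζ = Σᵢ F i ζ` on the closed unit disc with every `F i` complex
differentiable there and `‖F i ζ‖ ≤ b i`, `Σ b < ∞`, then `f` is differentiable on the open disc and continuous up to the boundary. -/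
theorem diffContOnCl_of_hasSum_majorant {F : ι → ℂ → ℂ} {f : ℂ → ℂ} {b : ι → ℝ} (hb : Summable b)
    (hsum : ∀ ζ ∈ closedBall (0 : ℂ) 1, HasSum (fun i => F i ζ) (f ζ))
    (hle : ∀ i, ∀ ζ ∈ closedBall (0 : ℂ) 1, ‖F i ζ‖ ≤ b i) (hF : ∀ i, DifferentiableOn ℂ (F i) (closedBall 0 1)) :
    DiffContOnCl ℂ f (ball 0 1) := by
  have heq : ∀ ζ ∈ closedBall (0 : ℂ) 1, ∑' i, F i ζ = f ζ := fun ζ hζ => (hsum ζ hζ).tsum_eq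
  refine ⟨?_, ?_⟩
  · have h := Complex.differentiableOn_tsum_of_summable_norm hb (fun i => (hF i).mono ball_subset_closedBall) isOpen_ball
      (fun i ζ hζ => hle i ζ (ball_subset_closedBall hζ))
    exact h.congr fun ζ hζ => (heq ζ (ball_subset_closedBall hζ)).symm
  · rw [closure_ball (0 : ℂ) one_ne_zero]
    have h := continuousOn_tsum (fun i => (hF i).continuousOn) hb fun i ζ hζ => hle i ζ hζ
    exact h.congr fun ζ hζ => (heq ζ hζ).symm

variable {C : Carriers} {P J Op Hist Ω : Type*} [NormedAddCommGroup Op] [NormedSpace ℂ Op] [NormedAddCommGroup Hist]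
  [NormedSpace ℂ Hist] [MeasurableSpace Ω] (𝒯 : TermIndexing C ι P J) (inc : P → P → Prop) [DecidableRel inc]
  (act : P → J → Op → Hist → ℂ)

/-- [folklore] **THE CAUCHY FACE OF L04-hist AT ACTIVITY LEVEL, X-BLIND CURRENCY.**  For ANY step model whose output IS the Ursell
series `out 𝒯 inc act`: the slack `BoxInClass M K W`, the termwise leaf's displayed majorant `TermBound K (term 𝒯 inc act) W κ a`
with budget `TermBudget a G` (printed KIND: [Balaban1988RG2Cluster] Lemma 3 (2.38) p. 20, (2.41) p. 21 — locators only) and leaf-08's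
STRUCTURE `ActExpLinearOn 𝒯 act D K W` ((2.14)–(2.15) p. 15, FORM) ⟹ `HistFibreEnvelopeCl M W κ G` — the tree's producer
`histFibreEnvelopeCl_of_termwise_hist` with `TermRep` (leaf-04's `termRep_b13_of_termBudget`) and `TermHistLineAnalytic`
(leaf-08's `termHistLineAnalytic_of_actExpLinear`) supplied BY NAME; NO analyticity hypothesis — the one-liner leaf-08 OFFERED at
journal l.6003, filed here with credit.  (Row O1-d1's finding l.5621:
with ABSOLUTE labels the X-blind majorant is volume-extensive — use the per-domain form below or anchored labels.) -/
theorem histFibreEnvelopeCl_b13_of_termBudget {M : StepModel C Op Hist}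
    (hM : ∀ k o h X, M.Out k o h X = out 𝒯 inc act k o h X) {K : ℕ → (ℕ → ℝ) → C.BgB → Set (Op × Hist)}
    {W : Set (ℕ → ℝ)} {κ G : ℝ} {a : ℕ → ι → ℝ} {D : ActData P J Op Hist Ω} (hbox : BoxInClass M K W)
    (hbd : TermBound K (term 𝒯 inc act) W κ a) (hbud : TermBudget a G) (hexp : ActExpLinearOn 𝒯 act D K W) :
    HistFibreEnvelopeCl M W κ G :=
  histFibreEnvelopeCl_of_termwise_hist hbox (termRep_b13_of_termBudget 𝒯 inc act hM hbd hbud) hbd hbud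
    (termHistLineAnalytic_of_actExpLinear (inc := inc) hexp)

/-- [folklore] **THE CAUCHY FACE OF L04-hist AT ACTIVITY LEVEL, PER-DOMAIN CURRENCY** (leaf-04's split binders, verbatim):
for ANY step model with `M.Out = out 𝒯 inc act`: the slack `BoxInClass M K W`; (i) an activity NORM majorant on the class — at every
class point `q` of step `k`, every factor of every tuple localizing at a step-`k` domain has `‖act Z j q.1 q.2‖ ≤ A k g U Z j` (the
SHAPE of [Balaban1988RG2Cluster] Lemma 3 (2.38) p. 20; displayed, locator only); (iii) the PER-DOMAIN budget
`Summable (actMajorant (A k g U) k X) ∧ Σ'ᵢ actMajorant … ≤ G·e^{−κd(X)}` (the per-X form of (2.41) p. 21; displayed); and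
leaf-08's STRUCTURE `ActExpLinearOn 𝒯 act D K W` ⟹ `HistFibreEnvelopeCl M W κ G`.  Along a history segment through a base point
the segment lies in the class (slack), the output there is the sum of its Ursell terms (d3), each analytic along the segment
(structure) and dominated by the summable per-domain majorant (M-test `diffContOnCl_of_hasSum_majorant`); the envelope on the
closed disc is leaf-04's `classBound_b13_of_actBound`. -/
theorem histFibreEnvelopeCl_b13_of_actBound {M : StepModel C Op Hist}
    (hM : ∀ k o h X, M.Out k o h X = out 𝒯 inc act k o h X) {K : ℕ → (ℕ → ℝ) → C.BgB → Set (Op × Hist)}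
    {W : Set (ℕ → ℝ)} {A : ℕ → (ℕ → ℝ) → C.BgB → P → J → ℝ} {κ G : ℝ} {D : ActData P J Op Hist Ω}
    (hbox : BoxInClass M K W)
    (hA : ∀ k, ∀ g ∈ W, ∀ (U : C.BgB) (q : Op × Hist), q ∈ K k g U → ∀ X : C.Dom, C.scale X = k →
      ∀ i, 𝒯.Rel k i X → ∀ m, ‖act (𝒯.poly i m) (𝒯.lab i m) q.1 q.2‖ ≤ A k g U (𝒯.poly i m) (𝒯.lab i m))
    (hbud : ∀ k, ∀ g ∈ W, ∀ (U : C.BgB) (X : C.Dom), C.scale X = k →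
      Summable (actMajorant 𝒯 inc (A k g U) k X) ∧ ∑' i, actMajorant 𝒯 inc (A k g U) k X i ≤ G * Real.exp (-(κ * C.d X)))
    (hexp : ActExpLinearOn 𝒯 act D K W) : HistFibreEnvelopeCl M W κ G := by
  have hcb : ClassBound M K W κ G := classBound_b13_of_actBound hM hA hbud
  have hline : TermHistLineAnalytic K (term 𝒯 inc act) W := termHistLineAnalytic_of_actExpLinear (inc := inc) hexp
  intro k g hg U p hp X hX o ho v hv
  have hseg : ∀ ζ ∈ closedBall (0 : ℂ) 1, (o, p.2 + ζ • v) ∈ K k g U :=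
    fun ζ hζ => hbox k g hg U p hp (histSegment_mem_box ho hv hζ)
  refine ⟨?_, fun ζ hζ => hcb k g hg U _ (hseg ζ hζ) X hX⟩
  obtain ⟨hs, -⟩ := hbud k g hg U X hX
  refine diffContOnCl_of_hasSum_majorant (F := fun i ζ => term 𝒯 inc act k i o (p.2 + ζ • v) X)
    (f := fun ζ => M.Out k o (p.2 + ζ • v) X) hs (fun ζ hζ => ?_) (fun i ζ hζ => ?_) fun i => hline k g hg U o p.2 v hseg X hX i
  · rw [hM]
    exact hasSum_term_out 𝒯 inc act (summable_term_of_actBound (hA k g hg U _ (hseg ζ hζ) X hX) hs)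
  · exact norm_term_le_actMajorant (hA k g hg U _ (hseg ζ hζ) X hX i)

end Cauchy

/-! ## §2 The Cauchy face for the MODEL OF RECORD `B13Represents.Assembly.step` -/

section ModelOfRecord

variable {C : Carriers} {E IOp Hist ι P J Ω : Type*} [NormedAddCommGroup Hist] [NormedSpace ℂ Hist] [MeasurableSpace Ω]
  (𝔄 : Assembly C E IOp Hist ι P J) (BHist : ℕ → ℝ)

/-- [folklore] **L04-hist, CAUCHY FACE, FOR THE ASSEMBLED STEP MODEL** (`Out = out 𝒯 inc act` by `rfl`): ROOM `rOp ≤ ROp`,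
`BHist + rHist ≤ RHist` (⟹ slack, leaf-09's `Assembly.boxInClass`) + the activity norm majorant and per-domain budget on the ball
class `ballClass (selfCtr 𝔄.raw 𝔄.histRef) ROp RHist` (displayed, (2.38)∕(2.41) KIND) + the structure `ActExpLinearOn` ⟹
`HistFibreEnvelopeCl (𝔄.step BHist) W κ G`. -/
theorem histFibreEnvelopeCl_step_of_actBound {W : Set (ℕ → ℝ)} {ROp RHist : ℕ → ℝ}
    {A : ℕ → (ℕ → ℝ) → C.BgB → P → J → ℝ} {κ G : ℝ} {D : ActData P J (OpDatum E) Hist Ω}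
    (hOp : ∀ k, 𝔄.rOp k ≤ ROp k) (hHist : ∀ k, BHist k + 𝔄.rHist k ≤ RHist k)
    (hA : ∀ k, ∀ g ∈ W, ∀ (U : C.BgB) (q : OpDatum E × Hist), q ∈ ballClass (selfCtr 𝔄.raw 𝔄.histRef) ROp RHist k g U →
      ∀ X : C.Dom, C.scale X = k → ∀ i, 𝔄.𝒯.Rel k i X → ∀ m,
        ‖𝔄.act (𝔄.𝒯.poly i m) (𝔄.𝒯.lab i m) q.1 q.2‖ ≤ A k g U (𝔄.𝒯.poly i m) (𝔄.𝒯.lab i m))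
    (hbud : ∀ k, ∀ g ∈ W, ∀ (U : C.BgB) (X : C.Dom), C.scale X = k →
      Summable (actMajorant 𝔄.𝒯 𝔄.inc (A k g U) k X) ∧
        ∑' i, actMajorant 𝔄.𝒯 𝔄.inc (A k g U) k X i ≤ G * Real.exp (-(κ * C.d X)))
    (hexp : ActExpLinearOn 𝔄.𝒯 𝔄.act D (ballClass (selfCtr 𝔄.raw 𝔄.histRef) ROp RHist) W) :
    HistFibreEnvelopeCl (𝔄.step BHist) W κ G :=
  histFibreEnvelopeCl_b13_of_actBound 𝔄.𝒯 𝔄.inc 𝔄.act (fun _ _ _ _ => rfl) (𝔄.boxInClass BHist W hOp hHist) hA hbud hexp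

end ModelOfRecord

end Summit.QuantumFields.BalabanUV.T4Continuum.B13TermHistEnvelope

end
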